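import Summits.CriticalPhenomena.PercolationContinuityZ3.Theorems.NearLinearTwoClusterDecay.Negative.Structure

/-!
# Crux `PercRayRenewal.TwoArmsRatioExponent` (stmt-CriticalPhenomena-4625), line `registered` —
# helpers for stub `stub_quasiMultiplicativity`: event identity, the annulus-local outer event, the
# disjoint-support product, the EASY (sub-multiplicative) direction, and the reduction of the
# stub to the missing 3D gluing estimate `Glue`

Helper file of the line lead (prover-line-stmt-CriticalPhenomena-4625-c2-0; written by its QM stub-worker,
wave 1), landed `--supports stmt-CriticalPhenomena-4625`.  Bond percolation on `ℤ³` at `p_c = criticalProbI 3`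
(`critBond`), vocabulary of `Theorems/NearLinearTwoClusterDecay/Negative/` (sibling crux stmt-CriticalPhenomena-5785).

Notation: `A₂(k, m) = twoClusterEvt k m` (two clusters of the configuration restricted to
`Λ(m) = box 3 m`, distinct inside `Λ(m)`, both meeting `Λ(k)` and `∂ⁱⁿΛ(m)`),
`f(m) = P_{p_c}(A₂(1, m))`, `E(r) = E⟦r⟧` = the pairs inside `Λ(r)`.

* `setOf_stubEvt_eq_twoClusterEvt` — the stub's set-builder event IS `twoClusterEvt k m`.
* `outer⟦r, n⟧` — `A₂(r, n)` evaluated on the thinned configuration `ω ∖ E(r)`: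
  determined by the pairs OUTSIDE `Λ(r)` (`determinedBy_outerTwoClusterEvt`), contains
  `A₂(k, n)` for every `k ≤ r` (`twoClusterEvt_subset_outerTwoClusterEvt`, last exit from `Λ(r)`).
* `real_inner_inter_outer` — `P(A₂(k, r) ∩ outer(r, n)) = P(A₂(k, r)) · P(outer(r, n))`
  (disjoint supports `E(r)`, `E(r)ᶜ`).
* `real_twoClusterEvt_le_mul` — EASY direction: `f(n) ≤ f(r) · P(outer(r, n))`, `1 ≤ r ≤ n`.
* `real_mul_real_le_real_inter` — `f(r) · P(A₂(r, n)) ≤ P(A₂(1, r) ∩ outer(r, n))`, so the stub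
  follows from `Glue : ∃ K, ∀ 1 ≤ r ≤ n, P(A₂(1, r) ∩ outer(r, n)) ≤ K · f(n)` (`stub_of_glue`),
  the honest 3D gluing estimate (conditionally on the inner two-arms event and the annulus-local
  two-distinct-crossings event, the glued event `A₂(1, n)` has probability `≥ 1/K`).
-/

namespace Summit.CriticalPhenomena.PercolationContinuityZ3.Theorems.TwoArmsRatioExponent

open MeasureTheory
open Literature.Probability.LatticeModels Literature.Probability.Percolation
open Summit.CriticalPhenomena.PercolationContinuityZ3.Theorems.NearLinearTwoClusterDecay.Negative

noncomputable section

/-! ## The stub's event is `twoClusterEvt` -/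

/-- The stub's set-builder event is `twoClusterEvt k m` (reorder two existentials). [folklore] -/
theorem setOf_stubEvt_eq_twoClusterEvt (k m : ℕ) :
    {ω : BondConfig (Site 3) | ∃ u ∈ box 3 k, ∃ v ∈ box 3 k,
        (∃ y ∈ innerBoundary (zdGraph 3) (box 3 m), ω ∈ openConnIn ↑(box 3 m) u y) ∧
        (∃ y ∈ innerBoundary (zdGraph 3) (box 3 m), ω ∈ openConnIn ↑(box 3 m) v y) ∧
        ω ∉ openConnIn ↑(box 3 m) u v} = twoClusterEvt k m := by
  ext ω
  constructor
  · rintro ⟨u, hu, v, hv, ⟨y, hy, h1⟩, ⟨y', hy', h2⟩, h3⟩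
    exact ⟨u, hu, v, hv, y, hy, y', hy', h1, h2, h3⟩
  · rintro ⟨u, hu, v, hv, y, hy, y', hy', h1, h2, h3⟩
    exact ⟨u, hu, v, hv, ⟨y, hy, h1⟩, ⟨y', hy', h2⟩, h3⟩

/-! ## The annulus-local outer event -/

set_option quotPrecheck false in
/-- `E⟦r⟧` — the pairs inside `Λ(r)` (the support of every event "inside `Λ(r)`"); a local
notation, not a definition. -/
local notation "E⟦" r "⟧" => Set.sym2 (↑(box 3 r) : Set (Site 3))

set_option quotPrecheck false in
/-- `outer⟦r, n⟧` — the OUTER two-cluster event of the annulus `(Λ(r), Λ(n))`: the two-cluster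
event `A₂(r, n)` of the thinned configuration `ω ∖ E(r)` (all pairs inside `Λ(r)` closed); a
local notation, not a definition. -/
local notation "outer⟦" r ", " n "⟧" =>
  (fun ω : BondConfig (Site 3) => ω ∩ (Set.sym2 (↑(box 3 r) : Set (Site 3)))ᶜ) ⁻¹' twoClusterEvt r n

/-- `twoClusterEvt k m` is determined by the pairs inside `Λ(m)`. [folklore] -/
theorem determinedBy_twoClusterEvt (k m : ℕ) : DeterminedBy (twoClusterEvt k m) E⟦m⟧ := by
  rw [determinedBy_iff]
  intro ω ω' h
  have key : ∀ a b : Site 3, ω ∈ openConnIn (↑(box 3 m) : Set (Site 3)) a b ↔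
      ω' ∈ openConnIn (↑(box 3 m) : Set (Site 3)) a b :=
    fun a b => (determinedBy_iff _ _).1 (DCT16.determinedBy_openConnIn _ a b subset_rfl) ω ω' h
  simp only [twoClusterEvt, Set.mem_setOf_eq, key]

/-- The outer event is determined by the pairs OUTSIDE `Λ(r)`. [folklore] -/
theorem determinedBy_outerTwoClusterEvt (r n : ℕ) :
    DeterminedBy (outer⟦r, n⟧) (E⟦r⟧)ᶜ := by
  rw [determinedBy_iff]
  intro ω ω' h
  simp only [Set.mem_preimage, h]

/-- `twoClusterEvt` is measurable. [folklore] -/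
theorem measurableSet_twoClusterEvt (k m : ℕ) : MeasurableSet (twoClusterEvt k m) := by
  have : twoClusterEvt k m = ⋃ x ∈ box 3 k, ⋃ x' ∈ box 3 k, badPair m x x' := by
    ext ω
    simp only [Set.mem_iUnion, exists_prop]
    exact mem_twoClusterEvt_iff
  rw [this]
  exact MeasurableSet.biUnion (Finset.countable_toSet _) fun x _ =>
    MeasurableSet.biUnion (Finset.countable_toSet _) fun x' _ => measurableSet_badPair m x x'

/-- Restriction to a fixed set of pairs is measurable. [folklore] -/
theorem measurable_inter_const (K : Set (Sym2 (Site 3))) :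
    Measurable fun ω : BondConfig (Site 3) => ω ∩ K :=
  (measurable_inter_edgeSigma K).mono (edgeSigma_le K) le_rfl

/-- The outer event is measurable. [folklore] -/
theorem measurableSet_outerTwoClusterEvt (r n : ℕ) : MeasurableSet (outer⟦r, n⟧) :=
  measurableSet_twoClusterEvt r n |>.preimage (measurable_inter_const _)

/-- **Last exit from `Λ(r)`.** An open path inside `Λ(n)` from `x ∈ Λ(r)` to `y` has a last
vertex `a ∈ Λ(r)`; from `a` on it uses no pair inside `Λ(r)`, so it survives the thinning
`ω ↦ ω ∖ E(r)`. [folklore] -/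
theorem exists_lastExit {ω : BondConfig (Site 3)} {r n : ℕ} {x y : Site 3} (hx : x ∈ box 3 r)
    (h : PathIn (openGraph ω) ↑(box 3 n) x y) :
    ∃ a ∈ box 3 r, PathIn (openGraph ω) ↑(box 3 n) a y ∧
      PathIn (openGraph (ω ∩ (E⟦r⟧)ᶜ)) ↑(box 3 n) a y := by
  rcases h.last_exit_or (C := (↑(box 3 r) : Set (Site 3))) (Finset.mem_coe.2 hx) with
    hy | ⟨a, b, ha, haA, hb, hab, hp⟩
  · exact ⟨y, Finset.mem_coe.1 hy, PathIn.refl h.right_mem, PathIn.refl h.right_mem⟩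
  · have hbA : b ∈ (↑(box 3 n) : Set (Site 3)) := hp.left_mem.1
    refine ⟨a, Finset.mem_coe.1 ha, ?_, ?_⟩
    · exact (PathIn.of_adj haA hbA hab).trans (hp.mono Set.sdiff_subset)
    · have hab' : (openGraph (ω ∩ (E⟦r⟧)ᶜ)).Adj a b := by
        rw [openGraph_adj] at hab ⊢
        exact ⟨⟨hab.1, fun hmem => hb (Set.mk_mem_sym2_iff.1 hmem).2⟩, hab.2⟩
      refine (PathIn.of_adj haA hbA hab').trans ((DCT16.pathIn_congrGraph ?_ hp).mono Set.sdiff_subset)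
      intro a' b' ha' _ hadj
      rw [openGraph_adj] at hadj ⊢
      exact ⟨⟨hadj.1, fun hmem => ha'.2 (Set.mk_mem_sym2_iff.1 hmem).1⟩, hadj.2⟩

/-- **`A₂(k, n) ⊆ outer(r, n)` for `k ≤ r`**: the final segments (after the last exit from
`Λ(r)`) of the two arms are two crossings by the thinned configuration, and they are not joined
by it inside `Λ(n)` (else the two clusters of `ω` would be joined inside `Λ(n)`). [folklore] -/
theorem twoClusterEvt_subset_outerTwoClusterEvt {k r : ℕ} (hkr : k ≤ r) (n : ℕ) :
    twoClusterEvt k n ⊆ outer⟦r, n⟧ := by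
  rintro ω ⟨x, hx, x', hx', y, hy, y', hy', hxy, hx'y', hxx'⟩
  rw [DCT16.mem_openConnIn_iff_pathIn] at hxy hx'y'
  obtain ⟨a, ha, hay, hay'⟩ := exists_lastExit (box_mono 3 hkr hx) hxy
  obtain ⟨a', ha', ha'y', ha'y''⟩ := exists_lastExit (box_mono 3 hkr hx') hx'y'
  show ω ∩ (E⟦r⟧)ᶜ ∈ twoClusterEvt r n
  refine ⟨a, ha, a', ha', y, hy, y', hy', DCT16.mem_openConnIn_iff_pathIn.2 hay',
    DCT16.mem_openConnIn_iff_pathIn.2 ha'y'', fun haa' => hxx' ?_⟩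
  have haa'ω : PathIn (openGraph ω) ↑(box 3 n) a a' :=
    (DCT16.mem_openConnIn_iff_pathIn.1 haa').mono_graph (openGraph_mono Set.inter_subset_left)
  exact DCT16.mem_openConnIn_iff_pathIn.2
    ((hxy.trans hay.symm).trans (haa'ω.trans (ha'y'.trans hx'y'.symm)))

/-! ## Disjoint supports: the product, the easy direction, the reduction -/

/-- **Product over disjoint supports**: `P(A₂(k, r) ∩ outer(r, n)) = P(A₂(k, r)) · P(outer(r, n))`.
[folklore] -/
theorem real_inner_inter_outer (k r n : ℕ) :
    critBond.real (twoClusterEvt k r ∩ outer⟦r, n⟧) =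
      critBond.real (twoClusterEvt k r) * critBond.real (outer⟦r, n⟧) :=
  bondPercolation_real_inter_of_disjoint (zdGraph 3) _ disjoint_compl_right
    (determinedBy_twoClusterEvt k r) (determinedBy_outerTwoClusterEvt r n)
    (measurableSet_twoClusterEvt k r) (measurableSet_outerTwoClusterEvt r n)

/-- Pointwise antitonicity of `A₂(k, ·)` in the outer box (first exit of the arms), `k ≤ m ≤ m'`,
`ω ⊆ E(ℤ³)`. [folklore] -/
theorem twoClusterEvt_anti {k m m' : ℕ} (hkm : k ≤ m) (hmm' : m ≤ m') {ω : BondConfig (Site 3)}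
    (hω : ω ⊆ (zdGraph 3).edgeSet) (h : ω ∈ twoClusterEvt k m') : ω ∈ twoClusterEvt k m := by
  rw [mem_twoClusterEvt_iff] at h ⊢
  obtain ⟨x, hx, x', hx', hb⟩ := h
  obtain ⟨j, rfl⟩ := Nat.exists_eq_add_of_le hkm
  obtain ⟨i, rfl⟩ := Nat.exists_eq_add_of_le hmm'
  refine ⟨x, hx, x', hx', ?_⟩
  rw [add_assoc] at hb
  exact badPair_add_antitone hx hx' hω (Nat.le_add_right j i) hb

/-- `A₂(1, n) ⊆ A₂(1, r) ∩ outer(r, n)` for `1 ≤ r ≤ n` and `ω ⊆ E(ℤ³)`. [folklore] -/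
theorem twoClusterEvt_subset_inter {r n : ℕ} (hr : 1 ≤ r) (hrn : r ≤ n) {ω : BondConfig (Site 3)}
    (hω : ω ⊆ (zdGraph 3).edgeSet) (h : ω ∈ twoClusterEvt 1 n) :
    ω ∈ twoClusterEvt 1 r ∩ outer⟦r, n⟧ :=
  ⟨twoClusterEvt_anti hr hrn hω h, twoClusterEvt_subset_outerTwoClusterEvt hr n h⟩

/-- **EASY (sub-multiplicative) direction**: `f(n) ≤ f(r) · P(outer(r, n))` for `1 ≤ r ≤ n`. [folklore] -/
theorem real_twoClusterEvt_le_mul {r n : ℕ} (hr : 1 ≤ r) (hrn : r ≤ n) :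
    critBond.real (twoClusterEvt 1 n) ≤
      critBond.real (twoClusterEvt 1 r) * critBond.real (outer⟦r, n⟧) := by
  rw [← real_inner_inter_outer]
  exact DCT16.real_mono_of_forall_subset_edgeSet _ _ fun ω hω h =>
    twoClusterEvt_subset_inter hr hrn hω h

/-- **Reduction of the stub's left side to one probability**:
`f(r) · P(A₂(r, n)) ≤ f(r) · P(outer(r, n)) = P(A₂(1, r) ∩ outer(r, n))`. [folklore] -/
theorem real_mul_real_le_real_inter (r n : ℕ) :
    critBond.real (twoClusterEvt 1 r) * critBond.real (twoClusterEvt r n) ≤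
      critBond.real (twoClusterEvt 1 r ∩ outer⟦r, n⟧) := by
  rw [real_inner_inter_outer]
  exact mul_le_mul_of_nonneg_left
    (measureReal_mono (twoClusterEvt_subset_outerTwoClusterEvt le_rfl n)) measureReal_nonneg

/-- **The missing 3D gluing estimate `Glue` implies the stub `stub_quasiMultiplicativity`**
(verbatim signature).  `Glue`: there is `K` such that for all `1 ≤ r ≤ n`,
`P(A₂(1, r) ∩ outer(r, n)) ≤ K · P(A₂(1, n))` — conditionally on the inner two-arms event
`A₂(1, r)` (support `E(r)`) and the annulus-local two-distinct-crossings event `outer(r, n)`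
(support `E(r)ᶜ`), the glued event `A₂(1, n)` has probability `≥ 1/K`.  This is the hard
(gluing) direction of Kesten–Nolin quasi-multiplicativity for the non-monotone two-distinct-clusters
event in `d = 3`; no proof is known (no arm separation / RSW for separating closed surfaces). [folklore] -/
theorem stub_of_glue
    (h : ∃ K : ℝ, ∀ r n : ℕ, 1 ≤ r → r ≤ n →
      critBond.real (twoClusterEvt 1 r ∩ outer⟦r, n⟧) ≤
        K * critBond.real (twoClusterEvt 1 n)) :
    ∃ K : ℝ, ∀ r n : ℕ, 1 ≤ r → r ≤ n →
      (bondPercolation (zdGraph 3) (criticalProbI 3)).real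
          {ω | ∃ u ∈ box 3 1, ∃ v ∈ box 3 1,
            (∃ y ∈ innerBoundary (zdGraph 3) (box 3 r), ω ∈ openConnIn ↑(box 3 r) u y) ∧
            (∃ y ∈ innerBoundary (zdGraph 3) (box 3 r), ω ∈ openConnIn ↑(box 3 r) v y) ∧
            ω ∉ openConnIn ↑(box 3 r) u v} *
        (bondPercolation (zdGraph 3) (criticalProbI 3)).real
          {ω | ∃ u ∈ box 3 r, ∃ v ∈ box 3 r,
            (∃ y ∈ innerBoundary (zdGraph 3) (box 3 n), ω ∈ openConnIn ↑(box 3 n) u y) ∧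
            (∃ y ∈ innerBoundary (zdGraph 3) (box 3 n), ω ∈ openConnIn ↑(box 3 n) v y) ∧
            ω ∉ openConnIn ↑(box 3 n) u v} ≤
      K * (bondPercolation (zdGraph 3) (criticalProbI 3)).real
          {ω | ∃ u ∈ box 3 1, ∃ v ∈ box 3 1,
            (∃ y ∈ innerBoundary (zdGraph 3) (box 3 n), ω ∈ openConnIn ↑(box 3 n) u y) ∧
            (∃ y ∈ innerBoundary (zdGraph 3) (box 3 n), ω ∈ openConnIn ↑(box 3 n) v y) ∧
            ω ∉ openConnIn ↑(box 3 n) u v} := by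
  obtain ⟨K, hK⟩ := h
  refine ⟨K, fun r n hr hrn => ?_⟩
  rw [setOf_stubEvt_eq_twoClusterEvt, setOf_stubEvt_eq_twoClusterEvt,
    setOf_stubEvt_eq_twoClusterEvt]
  exact (real_mul_real_le_real_inter r n).trans (hK r n hr hrn)

/-- The sandwich: both `f(n)` and the stub's left side `f(r) · P(A₂(r, n))` lie below
`f(r) · P(outer(r, n)) = P(A₂(1, r) ∩ outer(r, n))`, the quantity `Glue` compares with `f(n)`. [folklore] -/
theorem sandwich {r n : ℕ} (hr : 1 ≤ r) (hrn : r ≤ n) :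
    max (critBond.real (twoClusterEvt 1 n))
        (critBond.real (twoClusterEvt 1 r) * critBond.real (twoClusterEvt r n)) ≤
      critBond.real (twoClusterEvt 1 r) * critBond.real (outer⟦r, n⟧) :=
  max_le (real_twoClusterEvt_le_mul hr hrn)
    ((real_mul_real_le_real_inter r n).trans_eq (real_inner_inter_outer 1 r n))

/-! ## Registered sub-goal (spelled without notation, for `--supports stmt-CriticalPhenomena-4625`) -/

/-- **Sub-goal `qm_subMultiplicative` — the EASY (sub-multiplicative) half of quasi-multiplicativity
for the two-distinct-clusters event at `p_c(ℤ³)`**: for `1 ≤ r ≤ n`,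
`f(n) ≤ f(r) · P(outer(r, n))`, the outer event spelled out as the preimage of `A₂(r, n)` under
the thinning `ω ↦ ω ∖ E(Λ(r))`.  (The hard half is `Glue`, see `stub_of_glue`.) [folklore] -/
theorem qm_subMultiplicative : ∀ r n : ℕ, 1 ≤ r → r ≤ n → critBond.real (twoClusterEvt 1 n) ≤ critBond.real (twoClusterEvt 1 r) * critBond.real ((fun ω : BondConfig (Site 3) => ω ∩ (Set.sym2 (↑(box 3 r) : Set (Site 3)))ᶜ) ⁻¹' twoClusterEvt r n) :=
  fun _ _ hr hrn => real_twoClusterEvt_le_mul hr hrn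

end

end Summit.CriticalPhenomena.PercolationContinuityZ3.Theorems.TwoArmsRatioExponent
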